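import Summits.ABC.ABC.Theorems.TwistAmplificationMazurKaneLawShapeTransfer

-- Summit.ABC.ABC is the mandated summit-side namespace (single-conjunct summit); the lakefile sets the same option tree-wide.
set_option linter.dupNamespace false

/-!
# The transfer "shape-count bound at a certified record ⟹ record count" (crux stmt-ABC-2757, stub `recordAt_of_shapeBound`)

Line `fibre-toolkit-lp-wall-map` of the crux `Summit.ABC.ABC.Theses.TwistAmplification.MazurKaneLaw`,
record pipeline, last step: the generic TRANSFER from a bound for the Bernert–Browning–Lichtman–Teräväinen
shape counts `B_M(c; X, Y, Z) = AbcShapes.shapeCount` to the Mazur–Kane-type count of the crux.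

If for a record `(J, s₀, Vc)` (`1 ≤ J ≤ 40`, `s₀ > 0`, `Vc ≥ 0`) one has, in EVERY dimension `M = J + e`,
for every exponent `l` and `ε > 0` with `l + 3ε ≤ s₀` and every `η > 0`, a constant `K ≥ 0` with
`B_M ≤ K · C₀^{Vc+η}` on all data admissible for `(l, ε)`, then for every `s < s₀` and `ε > 0` there is
`C` with `#{abc triples (a,b,c) : c ≤ N, rad(abc) ≤ c^s} ≤ C · N^{Vc+ε}` for all `N ≥ 2`
(`Summit.ABC.ABC.Theorems.MazurKaneLaw.recordAt_of_shapeBound`). The proof follows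
`shapeTransfer` / `bernertEtAl2024_thm_1_3_holds`:

* put `l = (max(s,0) + s₀)/2`, so `0 ≤ l`, `s < l < s₀`;
* `ε' = min((s₀ - l)/3, ε/3, 1/4)`, so `0 < ε' < 1/2`, `l + 3ε' ≤ s₀`, `3ε'/2 ≤ ε/2`;
* `M = numShapes ε' = ⌊10/ε'²⌋ ≥ 160 ≥ J` (`ε' ≤ 1/4`), so `M = J + e`;
* the hypothesis at `(e, l, ε', η = ε/4)` and `AbcShapes.abcExponentCount_le_of_shapeCount_le`
  (BBLT Prop. 2.1) bound `N_l(N)` by `K · #classRange ε' N · N^{Vc+ε/4}`, and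
  `AbcShapes.card_classRange_le ε' (δ := ε/4)` bounds the number of classes by `C · N^{3ε'/2+ε/4}`;
  the exponents add up to at most `Vc + ε`;
* finally, for an abc triple `c ≥ 2`, so `rad(abc) ≤ c^s < c^l`: the set of the crux at `(s, N)` is
  contained in the set counted by `abcExponentCount l N`.
-/

namespace Summit.ABC.ABC.Theorems.MazurKaneLaw

open Literature.NumberTheory.DiophantineGeometry
open Literature.NumberTheory.DiophantineGeometry.AbcShapes

/-- `⌊10/ε²⌋ ≥ 160` for `0 < ε ≤ 1/4` (so the shape dimension `numShapes ε` exceeds every record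
dimension `J ≤ 40`). [folklore] -/
theorem le_numShapes_of_le_quarter {ε : ℝ} (hε : 0 < ε) (hε4 : ε ≤ 1 / 4) :
    160 ≤ AbcShapes.numShapes ε := by
  show 160 ≤ ⌊10 / ε ^ 2⌋₊
  refine Nat.le_floor ?_
  rw [Nat.cast_ofNat, le_div_iff₀ (by positivity)]
  have h1 : ε ^ 2 ≤ (1 / 4) ^ 2 := pow_le_pow_left₀ hε.le hε4 2
  nlinarith

/-- **Transfer of a shape-count bound to the record count.** Let `1 ≤ J ≤ 40`, `0 < s₀`, `0 ≤ Vc`, and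
suppose that for every dimension offset `e`, every `l` and `ε > 0` with `l + 3ε ≤ s₀`, and every `η > 0`
there is `K ≥ 0` with `B_{J+e}(c; X, Y, Z) ≤ K · C₀^{Vc+η}` for all data `Admissible l ε`. Then for
every `s < s₀` and `ε > 0` there is `C` with `#{abc triples, c ≤ N, rad(abc) ≤ c^s} ≤ C · N^{Vc+ε}`
for all `N ≥ 2`. Proof: `l = (max(s,0)+s₀)/2`, `ε' = min((s₀-l)/3, ε/3, 1/4)`, `numShapes ε' = J + e`
(`⌊10/ε'²⌋ ≥ 160`), `η = ε/4`; the reduction `abcExponentCount_le_of_shapeCount_le` and the class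
count `card_classRange_le ε' (δ := ε/4)` give `N_l(N) ≤ K C · N^{3ε'/2 + ε/4 + Vc + ε/4} ≤ K C · N^{Vc+ε}`,
and the crux's set lies in the set of `N_l(N)` because `rad(abc) ≤ c^s < c^l` (`c ≥ 2`). [folklore] -/
theorem recordAt_of_shapeBound : ∀ (J : ℕ) (s₀ Vc : ℝ), 1 ≤ J → J ≤ 40 → 0 < s₀ → 0 ≤ Vc → (∀ (e : ℕ) (l ε : ℝ), 0 < ε → l + 3 * ε ≤ s₀ → ∀ η : ℝ, 0 < η → ∃ K : ℝ, 0 ≤ K ∧ ∀ (C₀ c₁ c₂ c₃ : ℕ) (X Y Z : Fin (J + e) → ℕ), Literature.NumberTheory.DiophantineGeometry.AbcShapes.Admissible l ε C₀ c₁ c₂ c₃ X Y Z → (Literature.NumberTheory.DiophantineGeometry.AbcShapes.shapeCount c₁ c₂ c₃ X Y Z : ℝ) ≤ K * (C₀ : ℝ) ^ (Vc + η)) → ∀ s : ℝ, s < s₀ → ∀ ε : ℝ, 0 < ε → ∃ C : ℝ, ∀ N : ℕ, 2 ≤ N → (Set.ncard {t : ℕ × ℕ × ℕ | Literature.NumberTheory.DiophantineGeometry.IsABCTriple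 t.1 t.2.1 t.2.2 ∧ t.2.2 ≤ N ∧ ((Literature.NumberTheory.DiophantineGeometry.rad t.1 t.2.1 t.2.2 : ℕ) : ℝ) ≤ (t.2.2 : ℝ) ^ s} : ℝ) ≤ C * (N : ℝ) ^ (Vc + ε) := by
  intro J s₀ Vc _hJ hJ40 hs₀ hVc hK s hs ε hε
  -- the auxiliary exponent `l ∈ (s, s₀)` with `0 ≤ l`
  obtain ⟨l, hl⟩ : ∃ t : ℝ, t = (max s 0 + s₀) / 2 := ⟨_, rfl⟩
  have hmax : max s 0 < s₀ := max_lt hs hs₀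
  have hsl : s < l := by
    have := le_max_left s 0
    rw [hl]; linarith
  have hls₀ : l < s₀ := by rw [hl]; linarith
  have hl0 : (0 : ℝ) ≤ l := by
    have := le_max_right s 0
    rw [hl]; linarith
  -- the small parameter `ε'`
  obtain ⟨ε', hε'⟩ : ∃ t : ℝ, t = min (min ((s₀ - l) / 3) (ε / 3)) (1 / 4) := ⟨_, rfl⟩
  have hε'0 : 0 < ε' := by
    rw [hε']; exact lt_min (lt_min (by linarith) (by positivity)) (by norm_num)
  have hε'l : l + 3 * ε' ≤ s₀ := by
    have : ε' ≤ (s₀ - l) / 3 := by rw [hε']; exact (min_le_left _ _).trans (min_le_left _ _)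
    linarith
  have hε'ε : ε' ≤ ε / 3 := by rw [hε']; exact (min_le_left _ _).trans (min_le_right _ _)
  have hε'4 : ε' ≤ 1 / 4 := by rw [hε']; exact min_le_right _ _
  have hε'2 : ε' < 1 / 2 := by linarith
  have hη : 0 < ε / 4 := by positivity
  -- the dimension `M = numShapes ε' = J + e`
  obtain ⟨e, he⟩ : ∃ e : ℕ, numShapes ε' = J + e :=
    ⟨numShapes ε' - J, by have := le_numShapes_of_le_quarter hε'0 hε'4; omega⟩
  -- the shape-count bound at `(e, l, ε', η = ε/4)`
  obtain ⟨K, hK0, hB'⟩ := hK e l ε' hε'0 hε'l (ε / 4) hη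
  have hθ0 : (0 : ℝ) ≤ Vc + ε / 4 := by positivity
  have hB : ∀ (C₀ c₁ c₂ c₃ : ℕ) (X Y Z : Fin (numShapes ε') → ℕ),
      Admissible l ε' C₀ c₁ c₂ c₃ X Y Z →
        (shapeCount c₁ c₂ c₃ X Y Z : ℝ) ≤ K * (C₀ : ℝ) ^ (Vc + ε / 4) := by
    rw [he]; exact hB'
  -- the reduction to shape counts and the number of classes
  have hred := abcExponentCount_le_of_shapeCount_le hε'0 hε'2 hl0 hθ0 hK0 hB
  obtain ⟨C, hC0, hC⟩ := card_classRange_le ε' (δ := ε / 4) hη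
  refine ⟨K * C, fun N hN => ?_⟩
  have hN1 : (1 : ℝ) ≤ N := by exact_mod_cast (show 1 ≤ N by omega)
  have hN0 : (0 : ℝ) < N := by positivity
  -- the crux's set at `(s, N)` lies in the set counted by `abcExponentCount l N` (`c ≥ 2`)
  have hsub : {t : ℕ × ℕ × ℕ | IsABCTriple t.1 t.2.1 t.2.2 ∧ t.2.2 ≤ N ∧
      ((rad t.1 t.2.1 t.2.2 : ℕ) : ℝ) ≤ (t.2.2 : ℝ) ^ s} ⊆
      {t : ℕ × ℕ × ℕ | IsABCTriple t.1 t.2.1 t.2.2 ∧ t.2.2 ≤ N ∧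
        ((rad t.1 t.2.1 t.2.2 : ℕ) : ℝ) < (t.2.2 : ℝ) ^ l} := by
    rintro t ⟨ht, hN', hle⟩
    refine ⟨ht, hN', hle.trans_lt ?_⟩
    have h2 : (1 : ℝ) < (t.2.2 : ℝ) := by
      obtain ⟨ha, hb, habc, -⟩ := ht
      have : 2 ≤ t.2.2 := by omega
      exact_mod_cast this
    exact Real.rpow_lt_rpow_of_exponent_lt h2 hsl
  have h1 : (Set.ncard {t : ℕ × ℕ × ℕ | IsABCTriple t.1 t.2.1 t.2.2 ∧ t.2.2 ≤ N ∧
      ((rad t.1 t.2.1 t.2.2 : ℕ) : ℝ) ≤ (t.2.2 : ℝ) ^ s} : ℝ) ≤ (abcExponentCount l N : ℝ) := by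
    rw [abcExponentCount_def]
    exact_mod_cast Set.ncard_le_ncard hsub (abcExponentCount_finite _ N)
  -- the exponents: `3ε'/2 + ε/4 + Vc + ε/4 ≤ Vc + ε`
  have hexp : (N : ℝ) ^ (3 * ε' / 2 + ε / 4) * (N : ℝ) ^ (Vc + ε / 4) ≤
      (N : ℝ) ^ (Vc + ε) := by
    rw [← Real.rpow_add hN0]
    exact Real.rpow_le_rpow_of_exponent_le hN1 (by linarith)
  calc (Set.ncard {t : ℕ × ℕ × ℕ | IsABCTriple t.1 t.2.1 t.2.2 ∧ t.2.2 ≤ N ∧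
          ((rad t.1 t.2.1 t.2.2 : ℕ) : ℝ) ≤ (t.2.2 : ℝ) ^ s} : ℝ)
        ≤ (abcExponentCount l N : ℝ) := h1
    _ ≤ K * (classRange ε' N).card * (N : ℝ) ^ (Vc + ε / 4) := hred N
    _ ≤ K * (C * (N : ℝ) ^ (3 * ε' / 2 + ε / 4)) * (N : ℝ) ^ (Vc + ε / 4) :=
        mul_le_mul_of_nonneg_right (mul_le_mul_of_nonneg_left (hC N hN) hK0) (by positivity)
    _ = K * C * ((N : ℝ) ^ (3 * ε' / 2 + ε / 4) * (N : ℝ) ^ (Vc + ε / 4)) := by ring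
    _ ≤ K * C * (N : ℝ) ^ (Vc + ε) := mul_le_mul_of_nonneg_left hexp (mul_nonneg hK0 hC0.le)

end Summit.ABC.ABC.Theorems.MazurKaneLaw
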